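import Summits.QuantumAdvantage.QuantumAdvantage.Theses.SosSandwich
import Summits.QuantumAdvantage.QuantumAdvantage.Theorems.SosSandwichQueryDilation
import Literature.Computability.QuantumComplexity.AaronsonAmbainisL1Form
import HarnessLib

/-!
# `PB-AA ⟸ AA_Q + polynomial dilation`; `HomogeneousPBAAT ⟸ polynomial dilation`

Support theorems (reductions) for route `SosSandwich`, crux `PseudoBoundedAA` (stmt-QuantumAdvantage-15237) and
its repaired homogeneous rung `HomogeneousPBAAT` (stmt-QuantumAdvantage-27399); companion of
`SosSandwichQueryDilation` / `SosSandwichQueryDilationAddress`.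

Kaniewski–Lee–de Wolf (arXiv:1411.7280, Thm. 12): `K_T ⊆ cone(Q_T) ∩ (1 − cone(Q_T))` — every `p` that is
pseudo-bounded of order `T` is `L · acceptProb_A` on the cube for some `T`-query quantum algorithm `A` and some
dilation `L`.  Call POLYNOMIAL DILATION the quantitative form "`L² ≤ B·T^a` suffices" (NOT proved anywhere; the
address family forces `L² ≥ T/4`, `SosSandwichQueryDilationAddress.address_dilation_sq_ge`).  This file
records, with complete proofs, where that single cone-geometric estimate sits in the route's lattice:

* `homogeneousPBAAT_of_polyDilation` — polynomial dilation on the top-homogeneous corner of `K_T` implies the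
  route item `HomogeneousPBAAT`, `(c, C) = (a + 2, 4/B)` (via the dilated Escudero Gutiérrez rung
  `QueryDilation.dilatedHomogeneousRung`);
* `pseudoBoundedAA_of_aaQuery_of_polyDilation` — polynomial dilation on all of `K_T` TOGETHER WITH the
  quantum-only influence conjecture `AA_Q` (the inline statement of `aaQuery_of_pseudoBoundedAA` in
  `SosSandwichPseudoBoundedAAQuerySimulable`: every `T`-query acceptance probability with `Var ≥ ε` has a
  variable of influence `≥ C (ε/T)^c`) implies the crux `PseudoBoundedAA`, `(c', C') = (c(a+1)+1, C/B^c)`.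
  Since `PB-AA ⟹ AA_Q` is in the tree (`aaQuery_of_pseudoBoundedAA`), this says: GRANTED polynomial dilation,
  the route's crux PB-AA and the Aaronson–Ambainis conjecture for quantum algorithms are EQUIVALENT — the whole
  gap `K_T ⊋ Q_T` of the route's "why it might fail" is measured by the dilation factor.

Honest label: reductions only (the audit block shows both as conditional); no estimate of the dilation is
claimed.

Sources: KaniewskiLeeDewolf2015 (arXiv:1411.7280) Thm. 12; EscuderoGutierrez2023 (arXiv:2304.06713) Cor 1.7;
AaronsonAmbainis2014 Conj. 6 / Conj. 4.
-/

noncomputable section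

set_option linter.dupNamespace false

namespace Summit.QuantumAdvantage.QuantumAdvantage.Theorems.SosSandwich.QueryDilation

open Finset MvPolynomial Literature.Computability.Cryptography Literature.Computability.QuantumComplexity
open Literature.Computability.Complexity.LowDegree
open Summit.QuantumAdvantage.QuantumAdvantage.Theorems.SosSandwich.QueryTopLevel
open Summit.QuantumAdvantage.QuantumAdvantage.Theses.SosSandwich (PseudoBoundedAA HomogeneousPBAAT)

variable {N : ℕ}

/-! ### Small bookkeeping -/

/-- A `[0,1]`-valued polynomial has variance `≤ 1` (crude). [folklore] -/
theorem boolVariance_le_one_of_unitInterval (q : MvPolynomial (Fin N) ℝ)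
    (h : ∀ x, 0 ≤ evalBool q x ∧ evalBool q x ≤ 1) : boolVariance q ≤ 1 := by
  have hμ0 : 0 ≤ boolAvg (evalBool q) := boolAvg_nonneg fun x => (h x).1
  have hμ1 : boolAvg (evalBool q) ≤ 1 := AaronsonAmbainisL1.boolAvg_le_one fun x => (h x).2
  refine AaronsonAmbainisL1.boolAvg_le_one fun x => ?_
  have h1 : -1 ≤ evalBool q x - boolAvg (evalBool q) := by linarith [(h x).1]
  have h2 : evalBool q x - boolAvg (evalBool q) ≤ 1 := by linarith [(h x).2]
  nlinarith

/-! ### `HomogeneousPBAAT ⟸ polynomial dilation on the top-homogeneous corner` -/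

/-- **`HomogeneousPBAAT ⟸ polynomial dilation (quantitative Kaniewski–Lee–de Wolf).**  Suppose every polynomial
`p` that is pseudo-bounded of order `T ≥ 1` and top-homogeneous of order `T` is `L · acceptProb_A` on the cube
for some `T`-query quantum algorithm `A` and some real `L` with `L² ≤ B·T^a`.  Then the route item
`HomogeneousPBAAT` (stmt-QuantumAdvantage-27399) holds with exponent `c = a + 2` and constant `C = 4/B`: by the
dilated rung `4 Var² ≤ L² Inf_i ≤ B T^a Inf_i`, and `(Var/T)^{a+2} ≤ Var²/T^a` as `Var ≤ 1 ≤ T`.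
(Reduction only; the hypothesis is not proved here.) [cite: KaniewskiLeeDewolf2015, Thm. 12]
[cite: EscuderoGutierrez2023, Cor 1.7] -/
theorem homogeneousPBAAT_of_polyDilation
    (hD : ∃ (a : ℕ) (B : ℝ), 0 < B ∧ ∀ (N T : ℕ) (p : MvPolynomial (Fin N) ℝ), 1 ≤ T → PseudoBounded T p →
      (∀ x : Fin N → Bool, ∑ i : Fin N, (evalBool p x - evalBool p (Function.update x i (!x i))) =
        4 * (T : ℝ) * (evalBool p x - boolAvg (evalBool p))) →
      ∃ (A : QQueryAlg N) (L : ℝ), A.queries = T ∧ L ^ 2 ≤ B * (T : ℝ) ^ a ∧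
        ∀ x, evalBool p x = L * A.acceptProb x) :
    HomogeneousPBAAT := by
  obtain ⟨a, B, hB, hDb⟩ := hD
  refine ⟨a + 2, 4 / B, by positivity, fun N T p hT hp hhom _hv => ?_⟩
  -- the binders arrive in the route's inline spelling; name their tree-vocabulary forms (defeq)
  have hp' : PseudoBounded T p := hp
  have hhom' : ∀ x : Fin N → Bool, ∑ i : Fin N, (evalBool p x - evalBool p (Function.update x i (!x i))) =
      4 * (T : ℝ) * (evalBool p x - boolAvg (evalBool p)) := hhom
  obtain ⟨A, L, hA, hL, hpL⟩ := hDb N T p hT hp' hhom'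
  have hT' : 1 ≤ A.queries := by rw [hA]; exact hT
  obtain ⟨i, hi⟩ := dilatedHomogeneousRung A hT' p L hpL (fun x => by rw [hA]; exact hhom' x)
  refine ⟨i, ?_⟩
  show 4 / B * (boolVariance p / (T : ℝ)) ^ (a + 2) ≤ influence i p
  have hTpos : (0 : ℝ) < T := by exact_mod_cast hT
  have hT1 : (1 : ℝ) ≤ T := by exact_mod_cast hT
  have hV0 : 0 ≤ boolVariance p := boolVariance_nonneg p
  have hV1 : boolVariance p ≤ 1 := (boolVariance_le_quarter hp').trans (by norm_num)
  have hInf0 : 0 ≤ influence i p := influence_nonneg i p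
  have h1 : 4 * boolVariance p ^ 2 ≤ B * (T : ℝ) ^ a * influence i p :=
    hi.trans (mul_le_mul_of_nonneg_right hL hInf0)
  have h2 : (boolVariance p / (T : ℝ)) ^ (a + 2) ≤ boolVariance p ^ 2 / (T : ℝ) ^ a := by
    rw [div_pow, pow_add, pow_add, div_le_div_iff₀ (by positivity) (by positivity)]
    have hVa : boolVariance p ^ a ≤ 1 := pow_le_one₀ hV0 hV1
    have hT2 : (1 : ℝ) ≤ (T : ℝ) ^ 2 := one_le_pow₀ hT1
    calc boolVariance p ^ a * boolVariance p ^ 2 * (T : ℝ) ^ a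
        ≤ 1 * boolVariance p ^ 2 * (T : ℝ) ^ a := by gcongr
      _ = boolVariance p ^ 2 * ((T : ℝ) ^ a * 1) := by ring
      _ ≤ boolVariance p ^ 2 * ((T : ℝ) ^ a * (T : ℝ) ^ 2) := by gcongr
  calc 4 / B * (boolVariance p / (T : ℝ)) ^ (a + 2)
      ≤ 4 / B * (boolVariance p ^ 2 / (T : ℝ) ^ a) := by gcongr
    _ = 4 * boolVariance p ^ 2 / (B * (T : ℝ) ^ a) := by
        field_simp
    _ ≤ influence i p := by
        rw [div_le_iff₀ (by positivity)]
        linarith [h1]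

/-! ### `PB-AA ⟸ AA_Q + polynomial dilation on all of K_T` -/

/-- **`PseudoBoundedAA ⟸ AA_Q ∧ polynomial dilation.**  Suppose (i) `AA_Q`: there are `c, C > 0` such that every
polynomial `q` with the cube values of a `T`-query quantum algorithm (`T ≥ 1`) and `Var[q] ≥ ε > 0` has a
variable with `Inf_i[q] ≥ C (ε/T)^c` (the Aaronson–Ambainis conjecture restricted to genuine acceptance
probabilities; inline statement of `aaQuery_of_pseudoBoundedAA`), and (ii) polynomial dilation: every `p`
pseudo-bounded of order `T ≥ 1` is `L · acceptProb_A` on the cube for a `T`-query `A` with `L² ≤ B·T^a`.  Then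
the crux `PseudoBoundedAA` holds with `(c', C') = (c(a+1)+1, C/B^c)`.  Proof: `p = L·q`, `Var[q] = Var[p]/L²`,
apply `AA_Q` to `q` with `ε/L²`, pull back `Inf_i[p] = L² Inf_i[q] ≥ C L² (ε/(L²T))^c`, and use
`ε ≤ L²` (`Var[q] ≤ 1`) and `L² ≤ B T^a`.  With the tree's `PB-AA ⟹ AA_Q` this makes PB-AA and `AA_Q`
EQUIVALENT granted polynomial dilation. (Reduction only.) [cite: KaniewskiLeeDewolf2015, Thm. 12]
[cite: AaronsonAmbainis2014, Conj. 6] -/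
theorem pseudoBoundedAA_of_aaQuery_of_polyDilation
    (hQ : ∃ (c : ℕ) (C : ℝ), 0 < C ∧ ∀ (N : ℕ) (Q : QQueryAlg N) (q : MvPolynomial (Fin N) ℝ) (ε : ℝ),
      1 ≤ Q.queries → (∀ x, evalBool q x = Q.acceptProb x) → 0 < ε → ε ≤ boolVariance q →
        ∃ i : Fin N, C * (ε / Q.queries) ^ c ≤ influence i q)
    (hD : ∃ (a : ℕ) (B : ℝ), 0 < B ∧ ∀ (N T : ℕ) (p : MvPolynomial (Fin N) ℝ), 1 ≤ T → PseudoBounded T p →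
      ∃ (A : QQueryAlg N) (L : ℝ), A.queries = T ∧ L ^ 2 ≤ B * (T : ℝ) ^ a ∧
        ∀ x, evalBool p x = L * A.acceptProb x) :
    PseudoBoundedAA := by
  obtain ⟨c, C, hC, hQb⟩ := hQ
  obtain ⟨a, B, hB, hDb⟩ := hD
  refine ⟨c * (a + 1) + 1, C / B ^ c, by positivity, fun N T p ε hT hp hε hv => ?_⟩
  have hp' : PseudoBounded T p := hp
  have hv' : ε ≤ boolVariance p := hv
  obtain ⟨A, L, hA, hL, hpL⟩ := hDb N T p hT hp'
  have hT' : 1 ≤ A.queries := by rw [hA]; exact hT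
  have hTpos : (0 : ℝ) < T := by exact_mod_cast hT
  have hT1 : (1 : ℝ) ≤ T := by exact_mod_cast hT
  -- `L ≠ 0`: otherwise `p` vanishes on the cube and has variance `0 < ε`
  have hL0 : L ≠ 0 := by
    rintro rfl
    have hz : evalBool p = fun _ => 0 := funext fun x => by rw [hpL x, zero_mul]
    have hv0 : boolVariance p = 0 := by
      unfold boolVariance
      rw [hz, boolAvg_const]
      simp only [sub_self, zero_pow two_ne_zero, boolAvg_const]
    linarith
  have hL2 : 0 < L ^ 2 := by positivity
  -- the acceptance polynomial `q = L⁻¹ p`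
  set q : MvPolynomial (Fin N) ℝ := MvPolynomial.C L⁻¹ * p with hq
  have hqa : ∀ x, evalBool q x = A.acceptProb x := fun x => by
    rw [hq, AddrWitness.evalBool_C_mul', hpL x, ← mul_assoc, inv_mul_cancel₀ hL0, one_mul]
  have hVq : boolVariance q = (L ^ 2)⁻¹ * boolVariance p := by
    rw [hq, boolVariance_C_mul, inv_pow]
  have hIq : ∀ i, influence i q = (L ^ 2)⁻¹ * influence i p := fun i => by
    rw [hq, influence_C_mul, inv_pow]
  -- `Var[q] ≤ 1`, hence `ε ≤ L²`
  have hVq1 : boolVariance q ≤ 1 :=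
    boolVariance_le_one_of_unitInterval q fun x => by
      rw [hqa x]; exact ⟨A.acceptProb_nonneg x, A.acceptProb_le_one' x⟩
  have hεL : ε ≤ L ^ 2 := by
    have h1 : ε ≤ L ^ 2 * boolVariance q := by
      rw [hVq, ← mul_assoc, mul_inv_cancel₀ hL2.ne', one_mul]; exact hv'
    nlinarith [boolVariance_nonneg q]
  -- apply `AA_Q` to `q` with `ε / L²`
  have hε' : 0 < ε / L ^ 2 := div_pos hε hL2
  have hε'v : ε / L ^ 2 ≤ boolVariance q := by
    rw [hVq, div_eq_inv_mul]
    exact mul_le_mul_of_nonneg_left hv' (inv_nonneg.mpr hL2.le)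
  obtain ⟨i, hi⟩ := hQb N A q (ε / L ^ 2) hT' hqa hε' hε'v
  refine ⟨i, ?_⟩
  show C / B ^ c * (ε / (T : ℝ)) ^ (c * (a + 1) + 1) ≤ influence i p
  rw [hIq, hA] at hi
  -- `hi : C (ε/(L² T))^c ≤ Inf_i[p] / L²`, i.e. `C L² (ε/(L²T))^c ≤ Inf_i[p]`
  have hi' : C * L ^ 2 * (ε / L ^ 2 / (T : ℝ)) ^ c ≤ influence i p := by
    rw [← div_eq_inv_mul, le_div_iff₀ hL2] at hi
    calc C * L ^ 2 * (ε / L ^ 2 / (T : ℝ)) ^ c = C * (ε / L ^ 2 / (T : ℝ)) ^ c * L ^ 2 := by ring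
      _ ≤ influence i p := hi
  have hε1 : ε ≤ 1 := hv'.trans ((boolVariance_le_quarter hp').trans (by norm_num))
  -- lower-bound the left side of `hi'`
  have step1 : (ε / (B * (T : ℝ) ^ (a + 1))) ^ c ≤ (ε / L ^ 2 / (T : ℝ)) ^ c := by
    apply pow_le_pow_left₀ (by positivity)
    rw [div_div, pow_succ, ← mul_assoc]
    exact div_le_div_of_nonneg_left hε.le (by positivity) (mul_le_mul_of_nonneg_right hL (by positivity))
  have step2 : C / B ^ c * (ε / (T : ℝ)) ^ (c * (a + 1) + 1) ≤
      C * ε * (ε / (B * (T : ℝ) ^ (a + 1))) ^ c := by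
    -- `(ε/T)^{c(a+1)+1} = ((ε/T)^{a+1})^c · (ε/T) ≤ (ε/T^{a+1})^c · ε`
    rw [pow_succ, pow_mul']
    have e1 : (ε / (T : ℝ)) ^ (a + 1) ≤ ε / (T : ℝ) ^ (a + 1) := by
      rw [div_pow]
      exact div_le_div_of_nonneg_right (pow_le_of_le_one hε.le hε1 (Nat.succ_ne_zero a)) (by positivity)
    have e2 : ε / (T : ℝ) ≤ ε := div_le_self hε.le hT1
    have e3 : (ε / (T : ℝ) ^ (a + 1)) ^ c / B ^ c = (ε / (B * (T : ℝ) ^ (a + 1))) ^ c := by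
      rw [← div_pow, div_div, mul_comm]
    calc C / B ^ c * (((ε / (T : ℝ)) ^ (a + 1)) ^ c * (ε / (T : ℝ)))
        ≤ C / B ^ c * ((ε / (T : ℝ) ^ (a + 1)) ^ c * ε) := by gcongr
      _ = C * ε * ((ε / (T : ℝ) ^ (a + 1)) ^ c / B ^ c) := by ring
      _ = C * ε * (ε / (B * (T : ℝ) ^ (a + 1))) ^ c := by rw [e3]
  calc C / B ^ c * (ε / (T : ℝ)) ^ (c * (a + 1) + 1)
      ≤ C * ε * (ε / (B * (T : ℝ) ^ (a + 1))) ^ c := step2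
    _ ≤ C * L ^ 2 * (ε / (B * (T : ℝ) ^ (a + 1))) ^ c := by gcongr
    _ ≤ C * L ^ 2 * (ε / L ^ 2 / (T : ℝ)) ^ c := by gcongr
    _ ≤ influence i p := hi'

/-! ### `PB-AA ⟸ AA_Q + RELAXED polynomial dilation` (query overhead allowed)

The strict dilation of the previous theorem (SAME number `T` of queries) is plausibly EXPONENTIAL already on the
address family (naive composition of an exact-degree amplitude algorithm for the 4-bit address function costs a
factor `√2` per level and per path, i.e. `2^{Θ(T)}` overall; only `L ≥ √T/2` is proved,
`SosSandwichQueryDilationAddress`), whereas with a polynomial QUERY OVERHEAD the address family is a genuine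
acceptance probability (`G_k` is computed exactly by a decision tree of depth `3^k = T^{log₂3}`).  Since `AA_Q`
controls every Walsh level, the reduction survives any polynomial query overhead: -/

/-- **`PseudoBoundedAA ⟸ AA_Q ∧ relaxed polynomial dilation.**  Suppose (i) `AA_Q` as in
`pseudoBoundedAA_of_aaQuery_of_polyDilation`, and (ii) RELAXED polynomial dilation: every `p` pseudo-bounded of
order `T ≥ 1` is `L · acceptProb_A` on the cube for SOME quantum algorithm `A` with `1 ≤ #queries ≤ D·T^d` and
`L² ≤ B·T^a` (a quantitative Kaniewski–Lee–de Wolf theorem WITH query overhead; it holds with `L = 1` on the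
address family).  Then the crux `PseudoBoundedAA` holds with `(c', C') = (c(a+d+1)+1, C/(B·D)^c)`.
(Reduction only; (ii) is not proved here.) [cite: KaniewskiLeeDewolf2015, Thm. 12] [cite: AaronsonAmbainis2014, Conj. 6] -/
theorem pseudoBoundedAA_of_aaQuery_of_relaxedDilation
    (hQ : ∃ (c : ℕ) (C : ℝ), 0 < C ∧ ∀ (N : ℕ) (Q : QQueryAlg N) (q : MvPolynomial (Fin N) ℝ) (ε : ℝ),
      1 ≤ Q.queries → (∀ x, evalBool q x = Q.acceptProb x) → 0 < ε → ε ≤ boolVariance q →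
        ∃ i : Fin N, C * (ε / Q.queries) ^ c ≤ influence i q)
    (hD : ∃ (a d : ℕ) (B D : ℝ), 0 < B ∧ 0 < D ∧ ∀ (N T : ℕ) (p : MvPolynomial (Fin N) ℝ), 1 ≤ T →
      PseudoBounded T p →
      ∃ (A : QQueryAlg N) (L : ℝ), 1 ≤ A.queries ∧ (A.queries : ℝ) ≤ D * (T : ℝ) ^ d ∧
        L ^ 2 ≤ B * (T : ℝ) ^ a ∧ ∀ x, evalBool p x = L * A.acceptProb x) :
    PseudoBoundedAA := by
  obtain ⟨c, C, hC, hQb⟩ := hQ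
  obtain ⟨a, d, B, D, hB, hDpos, hDb⟩ := hD
  refine ⟨c * (a + d + 1) + 1, C / (B * D) ^ c, by positivity, fun N T p ε hT hp hε hv => ?_⟩
  have hp' : PseudoBounded T p := hp
  have hv' : ε ≤ boolVariance p := hv
  obtain ⟨A, L, hT', hAq, hL, hpL⟩ := hDb N T p hT hp'
  have hTpos : (0 : ℝ) < T := by exact_mod_cast hT
  have hT1 : (1 : ℝ) ≤ T := by exact_mod_cast hT
  have hT'pos : (0 : ℝ) < A.queries := by exact_mod_cast hT'
  -- `L ≠ 0`: otherwise `p` vanishes on the cube and has variance `0 < ε`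
  have hL0 : L ≠ 0 := by
    rintro rfl
    have hz : evalBool p = fun _ => 0 := funext fun x => by rw [hpL x, zero_mul]
    have hv0 : boolVariance p = 0 := by
      unfold boolVariance
      rw [hz, boolAvg_const]
      simp only [sub_self, zero_pow two_ne_zero, boolAvg_const]
    linarith
  have hL2 : 0 < L ^ 2 := by positivity
  -- the acceptance polynomial `q = L⁻¹ p`
  set q : MvPolynomial (Fin N) ℝ := MvPolynomial.C L⁻¹ * p with hq
  have hqa : ∀ x, evalBool q x = A.acceptProb x := fun x => by
    rw [hq, AddrWitness.evalBool_C_mul', hpL x, ← mul_assoc, inv_mul_cancel₀ hL0, one_mul]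
  have hVq : boolVariance q = (L ^ 2)⁻¹ * boolVariance p := by
    rw [hq, boolVariance_C_mul, inv_pow]
  have hIq : ∀ i, influence i q = (L ^ 2)⁻¹ * influence i p := fun i => by
    rw [hq, influence_C_mul, inv_pow]
  -- `Var[q] ≤ 1`, hence `ε ≤ L²`
  have hVq1 : boolVariance q ≤ 1 :=
    boolVariance_le_one_of_unitInterval q fun x => by
      rw [hqa x]; exact ⟨A.acceptProb_nonneg x, A.acceptProb_le_one' x⟩
  have hεL : ε ≤ L ^ 2 := by
    have h1 : ε ≤ L ^ 2 * boolVariance q := by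
      rw [hVq, ← mul_assoc, mul_inv_cancel₀ hL2.ne', one_mul]; exact hv'
    nlinarith [boolVariance_nonneg q]
  -- apply `AA_Q` to `q` with `ε / L²`
  have hε' : 0 < ε / L ^ 2 := div_pos hε hL2
  have hε'v : ε / L ^ 2 ≤ boolVariance q := by
    rw [hVq, div_eq_inv_mul]
    exact mul_le_mul_of_nonneg_left hv' (inv_nonneg.mpr hL2.le)
  obtain ⟨i, hi⟩ := hQb N A q (ε / L ^ 2) hT' hqa hε' hε'v
  refine ⟨i, ?_⟩
  show C / (B * D) ^ c * (ε / (T : ℝ)) ^ (c * (a + d + 1) + 1) ≤ influence i p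
  rw [hIq] at hi
  -- `hi : C (ε/(L² T'))^c ≤ Inf_i[p] / L²`, i.e. `C L² (ε/(L²T'))^c ≤ Inf_i[p]`
  have hi' : C * L ^ 2 * (ε / L ^ 2 / (A.queries : ℝ)) ^ c ≤ influence i p := by
    rw [← div_eq_inv_mul, le_div_iff₀ hL2] at hi
    calc C * L ^ 2 * (ε / L ^ 2 / (A.queries : ℝ)) ^ c
        = C * (ε / L ^ 2 / (A.queries : ℝ)) ^ c * L ^ 2 := by ring
      _ ≤ influence i p := hi
  have hε1 : ε ≤ 1 := hv'.trans ((boolVariance_le_quarter hp').trans (by norm_num))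
  -- `L² · T' ≤ B·D·T^{a+d+1}`
  have hLT : L ^ 2 * (A.queries : ℝ) ≤ B * D * (T : ℝ) ^ (a + d + 1) := by
    calc L ^ 2 * (A.queries : ℝ) ≤ B * (T : ℝ) ^ a * (D * (T : ℝ) ^ d) :=
          mul_le_mul hL hAq hT'pos.le (by positivity)
      _ = B * D * (T : ℝ) ^ (a + d) := by rw [pow_add]; ring
      _ ≤ B * D * (T : ℝ) ^ (a + d + 1) :=
          mul_le_mul_of_nonneg_left (pow_le_pow_right₀ hT1 (Nat.le_succ _)) (by positivity)
  have step1 : (ε / (B * D * (T : ℝ) ^ (a + d + 1))) ^ c ≤ (ε / L ^ 2 / (A.queries : ℝ)) ^ c := by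
    apply pow_le_pow_left₀ (by positivity)
    rw [div_div]
    exact div_le_div_of_nonneg_left hε.le (by positivity) hLT
  have step2 : C / (B * D) ^ c * (ε / (T : ℝ)) ^ (c * (a + d + 1) + 1) ≤
      C * ε * (ε / (B * D * (T : ℝ) ^ (a + d + 1))) ^ c := by
    rw [pow_succ, pow_mul']
    have e1 : (ε / (T : ℝ)) ^ (a + d + 1) ≤ ε / (T : ℝ) ^ (a + d + 1) := by
      rw [div_pow]
      exact div_le_div_of_nonneg_right (pow_le_of_le_one hε.le hε1 (Nat.succ_ne_zero _)) (by positivity)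
    have e2 : ε / (T : ℝ) ≤ ε := div_le_self hε.le hT1
    have e3 : (ε / (T : ℝ) ^ (a + d + 1)) ^ c / (B * D) ^ c = (ε / (B * D * (T : ℝ) ^ (a + d + 1))) ^ c := by
      rw [← div_pow, div_div, mul_comm]
    calc C / (B * D) ^ c * (((ε / (T : ℝ)) ^ (a + d + 1)) ^ c * (ε / (T : ℝ)))
        ≤ C / (B * D) ^ c * ((ε / (T : ℝ) ^ (a + d + 1)) ^ c * ε) := by gcongr
      _ = C * ε * ((ε / (T : ℝ) ^ (a + d + 1)) ^ c / (B * D) ^ c) := by ring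
      _ = C * ε * (ε / (B * D * (T : ℝ) ^ (a + d + 1))) ^ c := by rw [e3]
  calc C / (B * D) ^ c * (ε / (T : ℝ)) ^ (c * (a + d + 1) + 1)
      ≤ C * ε * (ε / (B * D * (T : ℝ) ^ (a + d + 1))) ^ c := step2
    _ ≤ C * L ^ 2 * (ε / (B * D * (T : ℝ) ^ (a + d + 1))) ^ c := by gcongr
    _ ≤ C * L ^ 2 * (ε / L ^ 2 / (A.queries : ℝ)) ^ c := by gcongr
    _ ≤ influence i p := hi'

end Summit.QuantumAdvantage.QuantumAdvantage.Theorems.SosSandwich.QueryDilation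

end
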